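import Literature.AlgebraicGeometry.Frobenioids.ArchimedeanFSM
import HarnessLib

/-!
# Frobenioids II, Proposition 3.4 (iii), (vi) in the COMPLEX REGIME — repaired nodes (RULING R37)

Mochizuki, *The geometry of Frobenioids II: poly-Frobenioids*, Kyushu J. Math. **62** (2008)
401–460, §3, Proposition 3.4 (iii), (vi), author's text p. 30 [cite: MochizukiFrdII2008, Prop 3.4 (iii) p.30].

`ArchimedeanFSM.lean` types Prop. 3.4 (i)–(viii) verbatim as closed named statements `Prop34_i … viii`
over the three towers `F → F₀ → D₀` (`F ∈ {A, N, R}`) for an ARBITRARY base `π : D ⥤ D₀`. abc-iut-L1-d3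
(discharger of Prop. 3.4) found that the typed (iii) — print: "FSM-morphisms of `F` project to
FSM-morphisms of `D`" ([FrdII] p. 30 l. 8), typed by `Prop34_iii` / `Tower.PropIII` as the reading
`IsFSM φ → IsFSM (T.toD.map φ)` (an FSM-morphism = a fiberwise-surjective monomorphism, [FrdI] §0) —
FAILS for the towers `A`, `N` and `R` at `π = 𝟭` (an FSM-morphism from a half-circle complex object to
a real object whose projection `Spec ℂ → Spec ℝ` is not a monomorphism of `D₀`; kernel refutations
`towerN_id_not_propIII`, `towerA_id_not_propIII`, `towerR_id_not_propIII` by d3), because print's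
(iii) silently uses that the relevant objects are complex. L1-lead RULING R37 (2026-08-25T21:28:38Z) adopts the repair (R-a), the **complex regime**:
every object of `D` lies over `Spec ℂ` (the regime in which [IUTchI] applies §3), under which d3
proves (iii) and the bundled (vi) for all three towers (`prop34_iii_of_isComplex`,
`prop34_vi_of_isComplex`). This file only NAMES the repaired nodes (one-line definitions, no proof):
`Prop34_iiiR π`, `Prop34_viR π`; d3 closes them by `exact`.
-/

namespace Literature.AlgebraicGeometry.Frobenioids

open CategoryTheory

namespace ArchFrd

universe v u

variable {D : Type u} [Category.{v} D] (π : D ⥤ D0)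

/-- The **complex regime** for a base `π : D → D₀`: every object of `D` lies over `Spec ℂ`
(as for the bases arising in [IUTchI]). [cite: MochizukiFrdII2008, Prop 3.4 (iii) p.30] -/
def IsComplexRegime : Prop := ∀ d : D, (π.obj d).IsComplex

/-- **Proposition 3.4 (iii)R** — repaired node FrdII:Prop3.4(iii)R (L1-lead RULING R37): Prop. 3.4
(iii) ("FSM-morphisms of `F` project to FSM-morphisms of `D`", [FrdII] p. 30 l. 8; typed by
`Prop34_iii` as `IsFSM φ → IsFSM (T.toD.map φ)` for the three towers) in the COMPLEX REGIME.
[cite: MochizukiFrdII2008, Prop 3.4 (iii) p.30] -/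
def Prop34_iiiR : Prop := IsComplexRegime π → Prop34_iii π

/-- **Proposition 3.4 (vi)R** — Prop. 3.4 (vi) (FSM- and FSMI-morphisms of `F`, bundled form) in the
COMPLEX REGIME (its FSMI clause rests on (iii)). [cite: MochizukiFrdII2008, Prop 3.4 (vi) p.30] -/
def Prop34_viR : Prop := IsComplexRegime π → Prop34_vi π

end ArchFrd

end Literature.AlgebraicGeometry.Frobenioids
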